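import Summits.QuantumFields.BalabanUV.Beta.GAN24.LegTowerMemberRows

/-!
# `BalabanUV.Beta.GAN24.LegTowerWindowSources` — binder row G-an2-4 ∕ (CONV-C), W-slot, the (α-0) parity re-cut, row L11 (Q-L): **THE SOCKET's WINDOW-SOURCE
# ROW (H2) UNPACKED — (H2) ⟸ THE SAME WINDOWS** (G-an2-4 formalisation swarm, leaf prover `b2b-balaban-gan24-formalise-leaf-03`, gen 68; FILE 1 of the journal
# INTENT [LEAF03-G68-ONLINE] «(H2) ⟸ THE SAME WINDOWS»; continues MY `GAN24/LegTowerSlavedRows` (gen 67, FILE 1) ∕ `GAN24/LegTowerMemberRows` (gen 67, FILE 8a))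

NOT IN PRINT; OUR BOOKKEEPING ([folklore] window bookkeeping BY NAME; 0 `def`, 0 cited facts, 0 `def … : Prop`, 0 sorry).  HONEST FRAMING (cell contract,
verbatim): «discharging `BetaPertH` makes Bałaban's UV stability UNCONDITIONAL — a real constructive-QFT result; it is NOT the continuum limit and NOT the Clay
problem.»  HONEST DEPENDENCY (verbatim): «continuum YM on T⁴ ⇐ BetaPertH ∧ nine spine estimates (0/9 proved); BetaPertH ⇐ (D1) ∧ (D4) ∧ CAP+tail; G-an2-4
gates asym, D1 and NE2/3/4.»

WHY.  The (Q-L) END (MY `LegTowerSlavedRows.good_tower_of_kfold_slaved` ∕ `LegTowerMemberRows.good_rdiv_tower_of_window_slaved_mem`) displays FOUR rows: (H1♮)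
«the k₀-fold leg chain contracts modulo the longitudinal amplitude», (H2) «the window's pushed sources are bounded», (H0) (first window — DISCHARGED, MY
`LegFirstWindowRows`), (H3) (the slaved part).  (H2), VERBATIM `∀ n, Good (Σ_{m<k₀} transport (legStepB kc K N) (n+m+1) (k₀−1−m) (rdiv ∘ F (n+m))) s`, is NOT a
one-step locality row: its summands are the one-step sources PUSHED THROUGH `k₀−1−m` lossy leg steps (RULING R-gan24p1-g36-1 (3): «every push in the tree is
lossy»), and on bounded tables `transport (legStepB kc K N) p q X = legChain kc K N p q (bsumPow N q ∘ X)` (MY g60 part 3 `transport_legStepB_eq`) — each summand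
IS an instance of the window theorem (leaf-01 g74's `locStencil₂_legChain_bsumPow_of_dressed_envelopes`, ANY start `p`, ANY length) at length `q < k₀`, read on the
SOURCE letter, with NO contraction asked.  So (H2) costs nothing new: it is supplied by THE SAME window family that supplies (H1♮) — at the lengths `q < k₀` —
plus the per-level SOURCE rows.  RATE LEDGER: every application of the window theorem costs its packaging factor (`108(d+1)` against the blocking `N^q`) in the
rate ONCE; the k₀-window absorbs it (`N^{k₀} ≥ 108(d+1)`), a short window does not — so the short windows read the sources in a SECOND size predicate `GoodS`∕`GoodLS`
(the sources' native, better rate `δ_S`) and land in the tower's `Good` (rate `δ`); `GoodS := Good` recovers the one-rate display.  This file types that reduction;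
(H2) disappears from the display.
WHAT.
* §1 ABSTRACT (`E` an additive commutative monoid; `Good` subadditive ∕ monotone with `Good 0 0`; `GoodL`, `GoodS`, `GoodLS`, `P` arbitrary; transports
  `T : ℕ → ℕ → E → E`, sources `src : ℕ → E`): `good_finset_sum`; **`good_windowSources`** — IF (H1w) «THE SHORT WINDOWS» `q < k₀ → P X → GoodS X c → GoodLS X g →
  Good (T p q X) (A·c + B·g)` (every start `p`; `A, B` arbitrary — NO contraction) and, for every level, (HS) `GoodS (src n) C_F`, (HSL) `GoodLS (src n) g_F`, (HSP) `P (src n)`,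
  THEN `∀ n, Good (Σ_{m<k₀} T (n+m+1) (k₀−1−m) (src (n+m))) (k₀·(A·C_F + B·g_F))` — (H2) with `s := k₀·(A·C_F + B·g_F)`; **`good_tower_of_windows_slaved`** —
  MY FILE 1's `good_tower_of_kfold_slaved` (window form `x (n+k₀) = T n k₀ (x n) + Σ_{m<k₀} T (n+m+1) (k₀−1−m) (src (n+m))`) with (H2) DISCHARGED:
  (H1♮)_{k₀} ∧ (H1w)_{<k₀} ∧ (HS)(HSL)(HSP) ∧ (H0) ∧ (H3) ⟹ `∀ n, Good (x n) (M + (Cg·σ + k₀·(A·C_F + B·g_F))·(1−θ)⁻¹)`;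
  **`good_firstWindow_of_windows`** ∕ **`good_tower_of_windows_slaved₀`** — (H0) TOO is the short windows' (from level `0`, on the initial member and the sources, in their
  own sizes): the `k₀`-UNIFORM first window; the END with (H2) AND (H0) discharged.
* §2 THE LEG TOWER (g60's objects `Δ n := fun s ↦ rdiv (T n s)`, closed one-step law `hstep`, step maps `legStepB kc K N`, sources `rdiv ∘ F n`; class by DIRECT
  MEMBERSHIP as in FILE 8a — members `hxP`, sources `hFP`): **`good_rdiv_tower_of_windows_slaved_mem`** — (H1w) in CHAIN form
  `q < k₀ → P W → bounded W → GoodS W c → GoodLS W g → Good (legChain kc K N p q (fun s ↦ bsumPow N q (W s))) (A·c + B·g)`.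
* §3 THE DRESSED COMB TOWER with a fixed in-block root, `LocStencil₂` currency (members at rate `δ`, sources at rate `δ_S`), from the affine recursion:
  **`locStencil₂_rdiv_tower_of_windows_slaved_comb_mem`**, and the display of record **`…_comb_mem₀`** (+ `good_rdiv_tower_of_windows_slaved_mem₀` in §2): (H0) replaced by the
  initial member's rows at the sources' rate — every displayed rate is fixed BEFORE `k₀` (no `δ ≤ δ₀(k₀)` versus `k₀ ≥ kmin(δ)` circle).
(H1♮), (H1w), (HS), (HSL), (HSP), (H0), (H3) are DISPLAYED, NOT discharged ((H1♮)∕(H1w): leaf-01's window theorem + the OWNER's block-ℓ¹ rows + `LegWindowArithmetic`;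
(HS): the source letter rows ⨾ MY `locStencil₂_rdiv`; (HSP): covariance of the sources ⨾ the OWNER's `zmode_rdiv_eq_zero` — later files).  Asserts NO bound on any
chain; discharges NOTHING of (Q-L) ∕ (C) ∕ «T2Shape» ∕ «T2Drift» ∕ (hW, hWall); NEVER «G-an2-4 closed» as (CONV-C); NOT D1, NOT `BetaPertH`, NOT continuum, NOT Clay;
not in print.  Unit `b2b-balaban-gan24-formalise-leaf-03` (gen 68), 2026-08-23.
-/

noncomputable section
open Finset
open scoped BigOperators
open Literature.MathematicalPhysics.QuantumFieldTheory
open Literature.MathematicalPhysics.QuantumFieldTheory.Balaban1983to89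
open Literature.MathematicalPhysics.QuantumFieldTheory.Balaban1983to89.Beta
open ExpKernelCalculus (MKer Site Decays)
open OneStepResolventKernel (Fib)
open OneStepKernelFamily (KInvStep)
open AffineAveraging (box toSite)
open BalabanCompositeJets (LocStencil₂)
open Summit.QuantumFields.BalabanUV.Beta.GAN24.T2RecursionAffine (lin4)
open Summit.QuantumFields.BalabanUV.Beta.HessKerDressedUnits (unitK decays_unitK)
open Summit.QuantumFields.BalabanUV.Beta.GAN24.CombesThomas (sfStep smStep)
open Summit.QuantumFields.BalabanUV.Beta.AxialDressingRooted (coDressKBmAt one_le_of_neZero decays_coDressKBmAt_KInvStep)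
open Summit.QuantumFields.BalabanUV.Beta.GAN24.Lin4SlotDivergence (hH_unitK_comb)
open Summit.QuantumFields.BalabanUV.Beta.GAN24.Lin4LegDivergence (hM_unitK_comb)
open Summit.QuantumFields.BalabanUV.Beta.GAN24.Lin4LegTower (rdiv bsum legStep rdiv_lin4_affine)
open Summit.QuantumFields.BalabanUV.Beta.GAN24.Lin4LegTowerUnroll (legStepB bsumPow legChain transport_legStepB_eq bddTab_rdiv bddTab_legStepB)
open Summit.QuantumFields.BalabanUV.Beta.GAN24.AffineUnroll (transport)
open Summit.QuantumFields.BalabanUV.Beta.GAN24.T2UnitSplitLevels (bdd₄_add)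
open Summit.QuantumFields.BalabanUV.Beta.GAN24.LegTowerRows (rdiv_tower_window)
open Summit.QuantumFields.BalabanUV.Beta.GAN24.WSlotT2OfPieces (locStencil₂_zero locStencil₂_add locStencil₂_mono)
open Summit.QuantumFields.BalabanUV.Beta.GAN24.LegTowerSlavedRows (good_tower_of_kfold_slaved)

namespace Summit.QuantumFields.BalabanUV.Beta.GAN24.LegTowerWindowSources

/-! ## §1 Abstract: the window-source row (H2) from the short windows and the per-level source rows -/

section Abstract

variable {E : Type*}

/-- [folklore] A finite sum of `Good` elements is `Good` with the sum of the constants (`Good` subadditive with `Good 0 0`). -/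
theorem good_finset_sum [AddCommMonoid E] {Good : E → ℝ → Prop}
    (hGadd : ∀ X Y c c', Good X c → Good Y c' → Good (X + Y) (c + c')) (hG0 : Good 0 0)
    {ι : Type*} (s : Finset ι) (f : ι → E) (c : ι → ℝ) (h : ∀ i ∈ s, Good (f i) (c i)) :
    Good (∑ i ∈ s, f i) (∑ i ∈ s, c i) := by
  classical
  induction s using Finset.induction_on with
  | empty => simpa only [Finset.sum_empty] using hG0
  | insert i s hi ih =>
    rw [Finset.sum_insert hi, Finset.sum_insert hi]
    exact hGadd _ _ _ _ (h i (Finset.mem_insert_self i s)) (ih fun j hj => h j (Finset.mem_insert_of_mem hj))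

/-- NOT IN PRINT; OUR BOOKKEEPING.  **THE WINDOW-SOURCE ROW (H2) FROM THE SHORT WINDOWS AND THE PER-LEVEL SOURCE ROWS.**  Data: transports `T p q : E → E`
(«`q` steps from level `p`»), sources `src : ℕ → E`, a class `P`, a subadditive ∕ monotone size predicate `Good` with `Good 0 0`, a second predicate `GoodL`.  IF
(H1w) THE SHORT WINDOWS `q < k₀ → P X → GoodS X c → GoodLS X g → Good (T p q X) (A·c + B·g)` (every start `p`; NO contraction asked; the sources' sizes `GoodS`,
`GoodLS` may differ from the tower's — a better rate), and for every level (HS) `GoodS (src n) C_F`, (HSL) `GoodLS (src n) g_F`, (HSP) `P (src n)`, THEN the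
k₀-window's pushed sources
`Σ_{m<k₀} T (n+m+1) (k₀−1−m) (src (n+m))` have `Good (…) (k₀·(A·C_F + B·g_F))` for EVERY `n` — the (Q-L) END's row (H2) with `s := k₀·(A·C_F + B·g_F)`. -/
theorem good_windowSources [AddCommMonoid E] {Good GoodS GoodLS : E → ℝ → Prop} {P : E → Prop}
    (hGadd : ∀ X Y c c', Good X c → Good Y c' → Good (X + Y) (c + c')) (hG0 : Good 0 0)
    {T : ℕ → ℕ → E → E} {src : ℕ → E} {k₀ : ℕ} {A B CF gF : ℝ}
    (Hw : ∀ (p q : ℕ) (X : E) (c g : ℝ), q < k₀ → P X → GoodS X c → GoodLS X g → Good (T p q X) (A * c + B * g))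
    (HS : ∀ n, GoodS (src n) CF) (HSL : ∀ n, GoodLS (src n) gF) (HSP : ∀ n, P (src n)) (n : ℕ) :
    Good (∑ m ∈ Finset.range k₀, T (n + m + 1) (k₀ - 1 - m) (src (n + m))) (k₀ * (A * CF + B * gF)) := by
  have h := good_finset_sum hGadd hG0 (Finset.range k₀) (fun m => T (n + m + 1) (k₀ - 1 - m) (src (n + m))) (fun _ => A * CF + B * gF)
    (fun m hm => Hw _ _ _ _ _ (by have := Finset.mem_range.mp hm; omega) (HSP _) (HS _) (HSL _))
  simpa only [Finset.sum_const, Finset.card_range, nsmul_eq_mul] using h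

/-- NOT IN PRINT; OUR BOOKKEEPING.  **THE k₀-WINDOW TOWER SOCKET WITH THE WINDOW-SOURCE ROW DISCHARGED** (= MY `LegTowerSlavedRows.good_tower_of_kfold_slaved` with
(H2) ⟸ `good_windowSources`).  A tower `x : ℕ → E` with the k₀-window form `x (n + k₀) = T n k₀ (x n) + Σ_{m<k₀} T (n+m+1) (k₀−1−m) (src (n+m))` whose members lie
in `P` (`hxP`).  IF
(H1♮) `P X → Good X c → GoodL X g → Good (T n k₀ X) (θ·c + Cg·g)` (`0 ≤ θ < 1`, `0 ≤ Cg`) — THE k₀-WINDOW, contraction modulo the longitudinal amplitude;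
(H1w) `q < k₀ → P X → GoodS X c → GoodLS X g → Good (T p q X) (A·c + B·g)` (`0 ≤ A, B`) — THE SHORT WINDOWS, no contraction, from the sources' sizes;
(HS) `GoodS (src n) C_F`, (HSL) `GoodLS (src n) g_F`, (HSP) `P (src n)` (`0 ≤ C_F, g_F`) — the per-level source rows;
(H0) `Good (x i) M` for `i < k₀`; (H3) `GoodL (x n) σ` — the slaved part;
THEN `Good (x n) (M + (Cg·σ + k₀·(A·C_F + B·g_F))·(1 − θ)⁻¹)` for EVERY `n`.  Nothing of (H1♮) ∕ (H1w) ∕ (H3) is claimed. -/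
theorem good_tower_of_windows_slaved [AddCommMonoid E] {Good GoodL GoodS GoodLS : E → ℝ → Prop} {P : E → Prop}
    (hGadd : ∀ X Y c c', Good X c → Good Y c' → Good (X + Y) (c + c')) (hGmono : ∀ X c c', c ≤ c' → Good X c → Good X c') (hG0 : Good 0 0)
    {x : ℕ → E} {T : ℕ → ℕ → E → E} {src : ℕ → E} {k₀ : ℕ} (hk : 0 < k₀)
    (hwin : ∀ n, x (n + k₀) = T n k₀ (x n) + ∑ m ∈ Finset.range k₀, T (n + m + 1) (k₀ - 1 - m) (src (n + m))) (hxP : ∀ n, P (x n))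
    {θ Cg A B CF gF M σ : ℝ} (hθ0 : 0 ≤ θ) (hθ1 : θ < 1) (hCg : 0 ≤ Cg) (hA : 0 ≤ A) (hB : 0 ≤ B) (hCF : 0 ≤ CF) (hgF : 0 ≤ gF)
    (hM : 0 ≤ M) (hσ : 0 ≤ σ)
    (H1 : ∀ (n : ℕ) (X : E) (c g : ℝ), P X → Good X c → GoodL X g → Good (T n k₀ X) (θ * c + Cg * g))
    (Hw : ∀ (p q : ℕ) (X : E) (c g : ℝ), q < k₀ → P X → GoodS X c → GoodLS X g → Good (T p q X) (A * c + B * g))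
    (HS : ∀ n, GoodS (src n) CF) (HSL : ∀ n, GoodLS (src n) gF) (HSP : ∀ n, P (src n))
    (H0 : ∀ i, i < k₀ → Good (x i) M) (H3 : ∀ n, GoodL (x n) σ) (n : ℕ) :
    Good (x n) (M + (Cg * σ + k₀ * (A * CF + B * gF)) * (1 - θ)⁻¹) :=
  good_tower_of_kfold_slaved (Φ := fun n X => T n k₀ X) hGadd hGmono hk hwin hxP hθ0 hθ1 hCg (by positivity) hM hσ H1
    (fun n => good_windowSources (GoodS := GoodS) (GoodLS := GoodLS) hGadd hG0 Hw HS HSL HSP n) H0 H3 n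

/-- NOT IN PRINT; OUR BOOKKEEPING.  **THE FIRST-WINDOW ROW (H0) FROM THE SHORT WINDOWS AND THE INITIAL MEMBER's SOURCE-SIZE ROWS** (A-3's rate ledger: a `k₀`-UNIFORM first
window).  If the tower has the window form FROM LEVEL `0` AT EVERY LENGTH, `x i = T 0 i (x 0) + Σ_{m<i} T (m+1) (i−1−m) (src m)` (`hwin0`), then the short windows (H1w) read on
the initial member (`GoodS (x 0) C₀`, `GoodLS (x 0) g₀`, `P (x 0)`) and on the sources give `Good (x i) (A·C₀ + B·g₀ + k₀·(A·C_F + B·g_F))` for EVERY `i < k₀` — (H0) with a constant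
and at sizes that do NOT shrink with `k₀` (the initial member and the sources are read in their own, native sizes). -/
theorem good_firstWindow_of_windows [AddCommMonoid E] {Good GoodS GoodLS : E → ℝ → Prop} {P : E → Prop}
    (hGadd : ∀ X Y c c', Good X c → Good Y c' → Good (X + Y) (c + c')) (hGmono : ∀ X c c', c ≤ c' → Good X c → Good X c') (hG0 : Good 0 0)
    {x : ℕ → E} {T : ℕ → ℕ → E → E} {src : ℕ → E} {k₀ : ℕ} {A B CF gF C₀ g₀ : ℝ} (hA : 0 ≤ A) (hB : 0 ≤ B) (hCF : 0 ≤ CF) (hgF : 0 ≤ gF)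
    (hwin0 : ∀ i, x i = T 0 i (x 0) + ∑ m ∈ Finset.range i, T (m + 1) (i - 1 - m) (src m))
    (Hw : ∀ (p q : ℕ) (X : E) (c g : ℝ), q < k₀ → P X → GoodS X c → GoodLS X g → Good (T p q X) (A * c + B * g))
    (HS : ∀ n, GoodS (src n) CF) (HSL : ∀ n, GoodLS (src n) gF) (HSP : ∀ n, P (src n))
    (Hx0 : GoodS (x 0) C₀) (HxL0 : GoodLS (x 0) g₀) (HxP0 : P (x 0)) (i : ℕ) (hi : i < k₀) :
    Good (x i) (A * C₀ + B * g₀ + k₀ * (A * CF + B * gF)) := by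
  rw [hwin0 i]
  have h1 : Good (T 0 i (x 0)) (A * C₀ + B * g₀) := Hw 0 i _ _ _ hi HxP0 Hx0 HxL0
  have h2 := good_finset_sum hGadd hG0 (Finset.range i) (fun m => T (m + 1) (i - 1 - m) (src m)) (fun _ => A * CF + B * gF)
    (fun m hm => Hw _ _ _ _ _ (by have := Finset.mem_range.mp hm; omega) (HSP _) (HS _) (HSL _))
  rw [Finset.sum_const, Finset.card_range, nsmul_eq_mul] at h2
  refine hGmono _ _ _ ?_ (hGadd _ _ _ _ h1 h2)
  have hik : (i : ℝ) ≤ k₀ := by exact_mod_cast hi.le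
  have hK : 0 ≤ A * CF + B * gF := by positivity
  nlinarith

/-- NOT IN PRINT; OUR BOOKKEEPING.  **THE k₀-WINDOW TOWER SOCKET WITH BOTH THE WINDOW-SOURCE ROW (H2) AND THE FIRST-WINDOW ROW (H0) DISCHARGED** (`good_tower_of_windows_slaved` ⨾
`good_firstWindow_of_windows`): (H1♮)_{k₀} ∧ (H1w)_{<k₀} ∧ (HS)(HSL)(HSP) ∧ (Hx0)(HxL0) (the initial member in the sources' sizes) ∧ (H3) ⟹
`Good (x n) (A·C₀ + B·g₀ + k₀·(A·C_F + B·g_F) + (Cg·σ + k₀·(A·C_F + B·g_F))·(1 − θ)⁻¹)` for EVERY `n` — every displayed size is `k₀`-free. -/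
theorem good_tower_of_windows_slaved₀ [AddCommMonoid E] {Good GoodL GoodS GoodLS : E → ℝ → Prop} {P : E → Prop}
    (hGadd : ∀ X Y c c', Good X c → Good Y c' → Good (X + Y) (c + c')) (hGmono : ∀ X c c', c ≤ c' → Good X c → Good X c') (hG0 : Good 0 0)
    {x : ℕ → E} {T : ℕ → ℕ → E → E} {src : ℕ → E} {k₀ : ℕ} (hk : 0 < k₀)
    (hwin : ∀ n, x (n + k₀) = T n k₀ (x n) + ∑ m ∈ Finset.range k₀, T (n + m + 1) (k₀ - 1 - m) (src (n + m)))
    (hwin0 : ∀ i, x i = T 0 i (x 0) + ∑ m ∈ Finset.range i, T (m + 1) (i - 1 - m) (src m)) (hxP : ∀ n, P (x n))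
    {θ Cg A B CF gF C₀ g₀ σ : ℝ} (hθ0 : 0 ≤ θ) (hθ1 : θ < 1) (hCg : 0 ≤ Cg) (hA : 0 ≤ A) (hB : 0 ≤ B) (hCF : 0 ≤ CF) (hgF : 0 ≤ gF)
    (hC₀ : 0 ≤ C₀) (hg₀ : 0 ≤ g₀) (hσ : 0 ≤ σ)
    (H1 : ∀ (n : ℕ) (X : E) (c g : ℝ), P X → Good X c → GoodL X g → Good (T n k₀ X) (θ * c + Cg * g))
    (Hw : ∀ (p q : ℕ) (X : E) (c g : ℝ), q < k₀ → P X → GoodS X c → GoodLS X g → Good (T p q X) (A * c + B * g))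
    (HS : ∀ n, GoodS (src n) CF) (HSL : ∀ n, GoodLS (src n) gF) (HSP : ∀ n, P (src n))
    (Hx0 : GoodS (x 0) C₀) (HxL0 : GoodLS (x 0) g₀) (H3 : ∀ n, GoodL (x n) σ) (n : ℕ) :
    Good (x n) (A * C₀ + B * g₀ + k₀ * (A * CF + B * gF) + (Cg * σ + k₀ * (A * CF + B * gF)) * (1 - θ)⁻¹) :=
  good_tower_of_windows_slaved hGadd hGmono hG0 hk hwin hxP hθ0 hθ1 hCg hA hB hCF hgF (by positivity) hσ H1 Hw HS HSL HSP
    (fun i hi => good_firstWindow_of_windows hGadd hGmono hG0 hA hB hCF hgF hwin0 Hw HS HSL HSP Hx0 HxL0 (hxP 0) i hi) H3 n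

end Abstract

/-! ## §2 The right-divergenced leg tower: the END with (H2) discharged, direct membership -/

section Leg

variable {d : ℕ} {N : ℕ} {kc : ℕ → ℝ} {K : ℕ → MKer (d + 1) (Fib d)}
  {T F : ℕ → (Fin (d + 1) → (Fin (d + 1) → ℤ) → Fin (d + 1) → (Fin (d + 1) → ℤ) → MKer (d + 1) (Fib d))}

/-- NOT IN PRINT; OUR BOOKKEEPING.  **THE (Q-L) END WITH THE SLAVED TERM AND THE WINDOW-SOURCE ROW DISCHARGED, DIRECT MEMBERSHIP** (= MY FILE 8a's
`good_rdiv_tower_of_window_slaved_mem` with (H2) ⟸ the short windows + source rows).  `Δ n := fun s ↦ rdiv (T n s)` under g60's closed one-step law `hstep`; all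
kernels decay, all members and sources bounded; members `hxP` AND source divergences `hFP` in the class `P`; `Good` subadditive ∕ monotone with `Good 0 0`; `GoodL`
arbitrary.  IF
(H1♮) for every level `n` and bounded `W ∈ P`: `Good W c → GoodL W g → Good (legChain kc K N n k₀ (fun s ↦ bsumPow N k₀ (W s))) (θ·c + Cg·g)`;
(H1w) THE SHORT WINDOWS IN CHAIN FORM: for every start `p`, every length `q < k₀` and bounded `W ∈ P`: `GoodS W c → GoodLS W g →
Good (legChain kc K N p q (fun s ↦ bsumPow N q (W s))) (A·c + B·g)` — the SAME window family, no contraction asked, read from the sources' sizes `GoodS`∕`GoodLS`;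
(HS) `GoodS (rdiv ∘ F n) C_F`, (HSL) `GoodLS (rdiv ∘ F n) g_F` for every `n` — the per-level source rows;
(H0) `Good (Δ i) M` on the first window; (H3) `GoodL (Δ n) σ`;
THEN `Good (Δ n) (M + (Cg·σ + k₀·(A·C_F + B·g_F))·(1 − θ)⁻¹)` for EVERY `n`.  Nothing of (H1♮) ∕ (H1w) ∕ (H3) is claimed. -/
theorem good_rdiv_tower_of_windows_slaved_mem (hK : ∀ m, ∃ δ C : ℝ, 0 < δ ∧ Decays (K m) C δ)
    (hT : ∀ m, ∃ B : ℝ, ∀ κ u κ' u' x z a b, |T m κ u κ' u' x z a b| ≤ B) (hF : ∀ m, ∃ B : ℝ, ∀ κ u κ' u' x z a b, |F m κ u κ' u' x z a b| ≤ B)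
    (hstep : ∀ m κ u κ' u', rdiv (T (m + 1) κ u κ' u')
      = legStep (kc m) (K m) (K m) N (fun κ u κ' u' => bsum N (rdiv (T m κ u κ' u'))) κ u κ' u' + rdiv (F m κ u κ' u'))
    (P : (Fin (d + 1) → (Fin (d + 1) → ℤ) → Fin (d + 1) → (Fin (d + 1) → ℤ) → MKer (d + 1) (Fib d)) → Prop)
    (hxP : ∀ n, P (fun κ u κ' u' => rdiv (T n κ u κ' u'))) (hFP : ∀ n, P (fun κ u κ' u' => rdiv (F n κ u κ' u')))
    {Good GoodL GoodS GoodLS : (Fin (d + 1) → (Fin (d + 1) → ℤ) → Fin (d + 1) → (Fin (d + 1) → ℤ) → MKer (d + 1) (Fib d)) → ℝ → Prop}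
    (hGadd : ∀ X Y c c', Good X c → Good Y c' → Good (X + Y) (c + c')) (hGmono : ∀ X c c', c ≤ c' → Good X c → Good X c') (hG0 : Good 0 0)
    {k₀ : ℕ} (hk : 0 < k₀) {θ Cg A B CF gF M σ : ℝ} (hθ0 : 0 ≤ θ) (hθ1 : θ < 1) (hCg : 0 ≤ Cg) (hA : 0 ≤ A) (hB : 0 ≤ B) (hCF : 0 ≤ CF)
    (hgF : 0 ≤ gF) (hM : 0 ≤ M) (hσ : 0 ≤ σ)
    (H1 : ∀ n (W : (Fin (d + 1) → (Fin (d + 1) → ℤ) → Fin (d + 1) → (Fin (d + 1) → ℤ) → MKer (d + 1) (Fib d))) (c g : ℝ), P W →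
      (∃ B : ℝ, ∀ κ u κ' u' x z a b, |W κ u κ' u' x z a b| ≤ B) → Good W c → GoodL W g →
        Good (legChain kc K N n k₀ (fun κ u κ' u' => bsumPow N k₀ (W κ u κ' u'))) (θ * c + Cg * g))
    (Hw : ∀ p q (W : (Fin (d + 1) → (Fin (d + 1) → ℤ) → Fin (d + 1) → (Fin (d + 1) → ℤ) → MKer (d + 1) (Fib d))) (c g : ℝ), q < k₀ → P W →
      (∃ B : ℝ, ∀ κ u κ' u' x z a b, |W κ u κ' u' x z a b| ≤ B) → GoodS W c → GoodLS W g →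
        Good (legChain kc K N p q (fun κ u κ' u' => bsumPow N q (W κ u κ' u'))) (A * c + B * g))
    (HS : ∀ n, GoodS (fun κ u κ' u' => rdiv (F n κ u κ' u')) CF) (HSL : ∀ n, GoodLS (fun κ u κ' u' => rdiv (F n κ u κ' u')) gF)
    (H0 : ∀ i, i < k₀ → Good (fun κ u κ' u' => rdiv (T i κ u κ' u')) M)
    (H3 : ∀ n, GoodL (fun κ u κ' u' => rdiv (T n κ u κ' u')) σ) (n : ℕ) :
    Good (fun κ u κ' u' => rdiv (T n κ u κ' u')) (M + (Cg * σ + k₀ * (A * CF + B * gF)) * (1 - θ)⁻¹) := by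
  refine good_tower_of_windows_slaved (Good := Good) (GoodL := GoodL) (GoodS := GoodS) (GoodLS := GoodLS)
    (P := fun W => P W ∧ ∃ B : ℝ, ∀ κ u κ' u' x z a b, |W κ u κ' u' x z a b| ≤ B)
    (x := fun i => fun κ u κ' u' => rdiv (T i κ u κ' u')) (T := fun p q W => transport (legStepB kc K N) p q W)
    (src := fun m => fun κ u κ' u' => rdiv (F m κ u κ' u'))
    hGadd hGmono hG0 hk (fun m => rdiv_tower_window hK hT hF hstep m k₀) (fun m => ⟨hxP m, bddTab_rdiv (hT m)⟩)
    hθ0 hθ1 hCg hA hB hCF hgF hM hσ (fun m W c g hW hc hg => ?_) (fun p q W c g hq hW hc hg => ?_) HS HSL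
    (fun m => ⟨hFP m, bddTab_rdiv (hF m)⟩) H0 H3 n
  · -- the k₀-window term is the pure chain on the block-summed member (g60 part 3)
    show Good (transport (legStepB kc K N) m k₀ W) (θ * c + Cg * g)
    rw [transport_legStepB_eq hK m k₀ hW.2]
    exact H1 m W c g hW.1 hW.2 hc hg
  · -- the short windows likewise
    show Good (transport (legStepB kc K N) p q W) (A * c + B * g)
    rw [transport_legStepB_eq hK p q hW.2]
    exact Hw p q W c g hq hW.1 hW.2 hc hg

/-- NOT IN PRINT; OUR BOOKKEEPING.  **THE SAME WITH THE FIRST-WINDOW ROW (H0) ALSO DISCHARGED** (the window form from level `0` at every length is g60's `rdiv_tower_window`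
at `n = 0`): (H1♮) ∧ (H1w) ∧ (HS)(HSL) ∧ the INITIAL member's source-size rows (Hx0) `GoodS (rdiv ∘ T 0) C₀`, (HxL0) `GoodLS (rdiv ∘ T 0) g₀` ∧ (H3) ⟹
`Good (Δ n) (A·C₀ + B·g₀ + k₀·(A·C_F + B·g_F) + (Cg·σ + k₀·(A·C_F + B·g_F))·(1 − θ)⁻¹)` for EVERY `n`. -/
theorem good_rdiv_tower_of_windows_slaved_mem₀ (hK : ∀ m, ∃ δ C : ℝ, 0 < δ ∧ Decays (K m) C δ)
    (hT : ∀ m, ∃ B : ℝ, ∀ κ u κ' u' x z a b, |T m κ u κ' u' x z a b| ≤ B) (hF : ∀ m, ∃ B : ℝ, ∀ κ u κ' u' x z a b, |F m κ u κ' u' x z a b| ≤ B)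
    (hstep : ∀ m κ u κ' u', rdiv (T (m + 1) κ u κ' u')
      = legStep (kc m) (K m) (K m) N (fun κ u κ' u' => bsum N (rdiv (T m κ u κ' u'))) κ u κ' u' + rdiv (F m κ u κ' u'))
    (P : (Fin (d + 1) → (Fin (d + 1) → ℤ) → Fin (d + 1) → (Fin (d + 1) → ℤ) → MKer (d + 1) (Fib d)) → Prop)
    (hxP : ∀ n, P (fun κ u κ' u' => rdiv (T n κ u κ' u'))) (hFP : ∀ n, P (fun κ u κ' u' => rdiv (F n κ u κ' u')))
    {Good GoodL GoodS GoodLS : (Fin (d + 1) → (Fin (d + 1) → ℤ) → Fin (d + 1) → (Fin (d + 1) → ℤ) → MKer (d + 1) (Fib d)) → ℝ → Prop}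
    (hGadd : ∀ X Y c c', Good X c → Good Y c' → Good (X + Y) (c + c')) (hGmono : ∀ X c c', c ≤ c' → Good X c → Good X c') (hG0 : Good 0 0)
    {k₀ : ℕ} (hk : 0 < k₀) {θ Cg A B CF gF C₀ g₀ σ : ℝ} (hθ0 : 0 ≤ θ) (hθ1 : θ < 1) (hCg : 0 ≤ Cg) (hA : 0 ≤ A) (hB : 0 ≤ B) (hCF : 0 ≤ CF)
    (hgF : 0 ≤ gF) (hC₀ : 0 ≤ C₀) (hg₀ : 0 ≤ g₀) (hσ : 0 ≤ σ)
    (H1 : ∀ n (W : (Fin (d + 1) → (Fin (d + 1) → ℤ) → Fin (d + 1) → (Fin (d + 1) → ℤ) → MKer (d + 1) (Fib d))) (c g : ℝ), P W →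
      (∃ B : ℝ, ∀ κ u κ' u' x z a b, |W κ u κ' u' x z a b| ≤ B) → Good W c → GoodL W g →
        Good (legChain kc K N n k₀ (fun κ u κ' u' => bsumPow N k₀ (W κ u κ' u'))) (θ * c + Cg * g))
    (Hw : ∀ p q (W : (Fin (d + 1) → (Fin (d + 1) → ℤ) → Fin (d + 1) → (Fin (d + 1) → ℤ) → MKer (d + 1) (Fib d))) (c g : ℝ), q < k₀ → P W →
      (∃ B : ℝ, ∀ κ u κ' u' x z a b, |W κ u κ' u' x z a b| ≤ B) → GoodS W c → GoodLS W g →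
        Good (legChain kc K N p q (fun κ u κ' u' => bsumPow N q (W κ u κ' u'))) (A * c + B * g))
    (HS : ∀ n, GoodS (fun κ u κ' u' => rdiv (F n κ u κ' u')) CF) (HSL : ∀ n, GoodLS (fun κ u κ' u' => rdiv (F n κ u κ' u')) gF)
    (Hx0 : GoodS (fun κ u κ' u' => rdiv (T 0 κ u κ' u')) C₀) (HxL0 : GoodLS (fun κ u κ' u' => rdiv (T 0 κ u κ' u')) g₀)
    (H3 : ∀ n, GoodL (fun κ u κ' u' => rdiv (T n κ u κ' u')) σ) (n : ℕ) :
    Good (fun κ u κ' u' => rdiv (T n κ u κ' u')) (A * C₀ + B * g₀ + k₀ * (A * CF + B * gF) + (Cg * σ + k₀ * (A * CF + B * gF)) * (1 - θ)⁻¹) := by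
  refine good_tower_of_windows_slaved₀ (Good := Good) (GoodL := GoodL) (GoodS := GoodS) (GoodLS := GoodLS)
    (P := fun W => P W ∧ ∃ B : ℝ, ∀ κ u κ' u' x z a b, |W κ u κ' u' x z a b| ≤ B)
    (x := fun i => fun κ u κ' u' => rdiv (T i κ u κ' u')) (T := fun p q W => transport (legStepB kc K N) p q W)
    (src := fun m => fun κ u κ' u' => rdiv (F m κ u κ' u'))
    hGadd hGmono hG0 hk (fun m => rdiv_tower_window hK hT hF hstep m k₀) (fun i => ?_) (fun m => ⟨hxP m, bddTab_rdiv (hT m)⟩)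
    hθ0 hθ1 hCg hA hB hCF hgF hC₀ hg₀ hσ (fun m W c g hW hc hg => ?_) (fun p q W c g hq hW hc hg => ?_) HS HSL
    (fun m => ⟨hFP m, bddTab_rdiv (hF m)⟩) Hx0 HxL0 H3 n
  · -- the window form from level 0 at length i
    have h := rdiv_tower_window hK hT hF hstep 0 i
    simp only [Nat.zero_add] at h
    exact h
  · show Good (transport (legStepB kc K N) m k₀ W) (θ * c + Cg * g)
    rw [transport_legStepB_eq hK m k₀ hW.2]
    exact H1 m W c g hW.1 hW.2 hc hg
  · show Good (transport (legStepB kc K N) p q W) (A * c + B * g)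
    rw [transport_legStepB_eq hK p q hW.2]
    exact Hw p q W c g hq hW.1 hW.2 hc hg

end Leg

/-! ## §3 The dressed comb tower with a fixed root, `LocStencil₂` currency, from the affine recursion -/

section Comb

variable {d : ℕ} {Lc : ℕ} [NeZero Lc] {r : Fin (d + 1) → ℕ}

/-- NOT IN PRINT; OUR BOOKKEEPING.  **THE (Q-L) END FOR THE DRESSED COMB TOWER (fixed root), `LocStencil₂` CURRENCY, DIRECT MEMBERSHIP, WITH (H2) DISCHARGED**
(`T (m+1) = lin4 (c m) K♮ᴱ_m Lc (T m) + F m`, `K♮ᴱ_m = unitK (sfStep Lc m) (smStep d Lc m) (coDressKBmAt (toSite r) Lc (KInvStep Lc m))`, `kc m = −(c m·(Lc^{d+1})⁻¹)`;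
`T 0` and the sources bounded; every member bounded by leaf-01's `lin4_bdd`, the closed one-step law by g60's `rdiv_lin4_affine` with g58's comb Ward laws — as in
FILE 8a): `hxP` ∧ `hFP` ∧ (H1♮ on `P`)_δ ∧ (H1w on `P`)_{δ_S → δ} ∧ (HS)_{δ_S} ∧ (HSL) ∧ (H0)_δ ∧ (H3) ⟹
`∀ n, LocStencil₂ (rdiv ∘ T n) (M + (Cg·σ + k₀·(A·C_F + B·g_F))·(1 − θ)⁻¹) δ` — ONE constant, EVERY level (the sources are read at their own rate `δ_S`, the short
windows land at the tower's rate `δ`).  The rows are DISPLAYED, not discharged. -/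
theorem locStencil₂_rdiv_tower_of_windows_slaved_comb_mem (hr : r ∈ box (d + 1) Lc) (c : ℕ → ℝ)
    {T F : ℕ → (Fin (d + 1) → (Fin (d + 1) → ℤ) → Fin (d + 1) → (Fin (d + 1) → ℤ) → MKer (d + 1) (Fib d))}
    (hT0 : ∃ B : ℝ, ∀ κ u κ' u' x z a b, |T 0 κ u κ' u' x z a b| ≤ B) (hF : ∀ m, ∃ B : ℝ, ∀ κ u κ' u' x z a b, |F m κ u κ' u' x z a b| ≤ B)
    (hrec : ∀ m, T (m + 1) = lin4 (c m) (unitK (sfStep Lc m) (smStep d Lc m) (coDressKBmAt (toSite r) Lc (KInvStep (d := d) Lc m))) Lc (T m) + F m)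
    (P : (Fin (d + 1) → (Fin (d + 1) → ℤ) → Fin (d + 1) → (Fin (d + 1) → ℤ) → MKer (d + 1) (Fib d)) → Prop)
    (hxP : ∀ n, P (fun κ u κ' u' => rdiv (T n κ u κ' u'))) (hFP : ∀ n, P (fun κ u κ' u' => rdiv (F n κ u κ' u')))
    {GoodL GoodLS : (Fin (d + 1) → (Fin (d + 1) → ℤ) → Fin (d + 1) → (Fin (d + 1) → ℤ) → MKer (d + 1) (Fib d)) → ℝ → Prop} (δ δS : ℝ)
    {k₀ : ℕ} (hk : 0 < k₀) {θ Cg A B CF gF M σ : ℝ} (hθ0 : 0 ≤ θ) (hθ1 : θ < 1) (hCg : 0 ≤ Cg) (hA : 0 ≤ A) (hB : 0 ≤ B) (hCF : 0 ≤ CF)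
    (hgF : 0 ≤ gF) (hM : 0 ≤ M) (hσ : 0 ≤ σ)
    (H1 : ∀ n (W : (Fin (d + 1) → (Fin (d + 1) → ℤ) → Fin (d + 1) → (Fin (d + 1) → ℤ) → MKer (d + 1) (Fib d))) (C g : ℝ), P W →
      (∃ B : ℝ, ∀ κ u κ' u' x z a b, |W κ u κ' u' x z a b| ≤ B) → LocStencil₂ W C δ → GoodL W g →
        LocStencil₂ (legChain (fun m => -(c m * ((Lc : ℝ) ^ (d + 1))⁻¹))
          (fun m => unitK (sfStep Lc m) (smStep d Lc m) (coDressKBmAt (toSite r) Lc (KInvStep (d := d) Lc m))) Lc n k₀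
          (fun κ u κ' u' => bsumPow Lc k₀ (W κ u κ' u'))) (θ * C + Cg * g) δ)
    (Hw : ∀ p q (W : (Fin (d + 1) → (Fin (d + 1) → ℤ) → Fin (d + 1) → (Fin (d + 1) → ℤ) → MKer (d + 1) (Fib d))) (C g : ℝ), q < k₀ → P W →
      (∃ B : ℝ, ∀ κ u κ' u' x z a b, |W κ u κ' u' x z a b| ≤ B) → LocStencil₂ W C δS → GoodLS W g →
        LocStencil₂ (legChain (fun m => -(c m * ((Lc : ℝ) ^ (d + 1))⁻¹))
          (fun m => unitK (sfStep Lc m) (smStep d Lc m) (coDressKBmAt (toSite r) Lc (KInvStep (d := d) Lc m))) Lc p q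
          (fun κ u κ' u' => bsumPow Lc q (W κ u κ' u'))) (A * C + B * g) δ)
    (HS : ∀ n, LocStencil₂ (fun κ u κ' u' => rdiv (F n κ u κ' u')) CF δS) (HSL : ∀ n, GoodLS (fun κ u κ' u' => rdiv (F n κ u κ' u')) gF)
    (H0 : ∀ i, i < k₀ → LocStencil₂ (fun κ u κ' u' => rdiv (T i κ u κ' u')) M δ)
    (H3 : ∀ n, GoodL (fun κ u κ' u' => rdiv (T n κ u κ' u')) σ) (n : ℕ) :
    LocStencil₂ (fun κ u κ' u' => rdiv (T n κ u κ' u')) (M + (Cg * σ + k₀ * (A * CF + B * gF)) * (1 - θ)⁻¹) δ := by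
  have hK : ∀ m, ∃ δ C : ℝ, 0 < δ ∧ Decays (unitK (sfStep Lc m) (smStep d Lc m) (coDressKBmAt (toSite r) Lc (KInvStep (d := d) Lc m))) C δ := by
    intro m
    obtain ⟨δK, CK, hδK, -, hG⟩ := decays_coDressKBmAt_KInvStep (d := d) hr m
    exact ⟨δK, _, hδK, decays_unitK hG⟩
  have hTb : ∀ m, ∃ B : ℝ, ∀ κ u κ' u' x z a b, |T m κ u κ' u' x z a b| ≤ B := by
    intro m
    induction m with
    | zero => exact hT0
    | succ m ih =>
      obtain ⟨δ', C', hδ', hKm⟩ := hK m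
      rw [hrec m]
      exact bdd₄_add (Lin4Additive.lin4_bdd hKm hδ' (c m) Lc ih) (hF m)
  have hstep : ∀ m κ u κ' u', rdiv (T (m + 1) κ u κ' u')
      = legStep (-(c m * ((Lc : ℝ) ^ (d + 1))⁻¹)) (unitK (sfStep Lc m) (smStep d Lc m) (coDressKBmAt (toSite r) Lc (KInvStep (d := d) Lc m)))
          (unitK (sfStep Lc m) (smStep d Lc m) (coDressKBmAt (toSite r) Lc (KInvStep (d := d) Lc m))) Lc
          (fun κ u κ' u' => bsum Lc (rdiv (T m κ u κ' u'))) κ u κ' u' + rdiv (F m κ u κ' u') := by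
    intro m κ u κ' u'
    obtain ⟨δ', C', hδ', hKm⟩ := hK m
    obtain ⟨B', hB'⟩ := hTb m
    rw [hrec m]
    exact rdiv_lin4_affine hKm hδ' (one_le_of_neZero Lc) (c m) hB' (hH_unitK_comb hr m) (hM_unitK_comb m) (F m) κ u κ' u'
  exact good_rdiv_tower_of_windows_slaved_mem (N := Lc) (kc := (fun m => -(c m * ((Lc : ℝ) ^ (d + 1))⁻¹)))
    (K := (fun m => unitK (sfStep Lc m) (smStep d Lc m) (coDressKBmAt (toSite r) Lc (KInvStep (d := d) Lc m)))) hK hTb hF hstep P hxP hFP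
    (Good := fun X C => LocStencil₂ X C δ) (GoodL := GoodL) (GoodS := fun X C => LocStencil₂ X C δS) (GoodLS := GoodLS)
    (fun _ _ _ _ hX hY => locStencil₂_add hX hY) (fun _ _ _ hCC hX => locStencil₂_mono hX hCC) (locStencil₂_zero (d := d) δ)
    hk hθ0 hθ1 hCg hA hB hCF hgF hM hσ H1 Hw HS HSL H0 H3 n

/-- NOT IN PRINT; OUR BOOKKEEPING.  **THE (Q-L) END FOR THE DRESSED COMB TOWER, `LocStencil₂` CURRENCY, WITH (H2) AND (H0) DISCHARGED** — the display of record after A-3's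
rate ledger: (H1♮ on `P`)_δ ∧ (H1w on `P`)_{δS→δ} ∧ (HS)_{δS} ∧ (HSL) ∧ the initial member's rows (Hx0)_{δS} `LocStencil₂ (rdiv ∘ T 0) C₀ δS`, (HxL0) `GoodLS (rdiv ∘ T 0) g₀` ∧ (H3)
⟹ `∀ n, LocStencil₂ (rdiv ∘ T n) (A·C₀ + B·g₀ + k₀·(A·C_F + B·g_F) + (Cg·σ + k₀·(A·C_F + B·g_F))·(1 − θ)⁻¹) δ`; every displayed rate (`δS` for the sources and the initial
member, `δ` for the tower) is a number fixed BEFORE `k₀`. -/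
theorem locStencil₂_rdiv_tower_of_windows_slaved_comb_mem₀ (hr : r ∈ box (d + 1) Lc) (c : ℕ → ℝ)
    {T F : ℕ → (Fin (d + 1) → (Fin (d + 1) → ℤ) → Fin (d + 1) → (Fin (d + 1) → ℤ) → MKer (d + 1) (Fib d))}
    (hT0 : ∃ B : ℝ, ∀ κ u κ' u' x z a b, |T 0 κ u κ' u' x z a b| ≤ B) (hF : ∀ m, ∃ B : ℝ, ∀ κ u κ' u' x z a b, |F m κ u κ' u' x z a b| ≤ B)
    (hrec : ∀ m, T (m + 1) = lin4 (c m) (unitK (sfStep Lc m) (smStep d Lc m) (coDressKBmAt (toSite r) Lc (KInvStep (d := d) Lc m))) Lc (T m) + F m)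
    (P : (Fin (d + 1) → (Fin (d + 1) → ℤ) → Fin (d + 1) → (Fin (d + 1) → ℤ) → MKer (d + 1) (Fib d)) → Prop)
    (hxP : ∀ n, P (fun κ u κ' u' => rdiv (T n κ u κ' u'))) (hFP : ∀ n, P (fun κ u κ' u' => rdiv (F n κ u κ' u')))
    {GoodL GoodLS : (Fin (d + 1) → (Fin (d + 1) → ℤ) → Fin (d + 1) → (Fin (d + 1) → ℤ) → MKer (d + 1) (Fib d)) → ℝ → Prop} (δ δS : ℝ)
    {k₀ : ℕ} (hk : 0 < k₀) {θ Cg A B CF gF C₀ g₀ σ : ℝ} (hθ0 : 0 ≤ θ) (hθ1 : θ < 1) (hCg : 0 ≤ Cg) (hA : 0 ≤ A) (hB : 0 ≤ B) (hCF : 0 ≤ CF)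
    (hgF : 0 ≤ gF) (hC₀ : 0 ≤ C₀) (hg₀ : 0 ≤ g₀) (hσ : 0 ≤ σ)
    (H1 : ∀ n (W : (Fin (d + 1) → (Fin (d + 1) → ℤ) → Fin (d + 1) → (Fin (d + 1) → ℤ) → MKer (d + 1) (Fib d))) (C g : ℝ), P W →
      (∃ B : ℝ, ∀ κ u κ' u' x z a b, |W κ u κ' u' x z a b| ≤ B) → LocStencil₂ W C δ → GoodL W g →
        LocStencil₂ (legChain (fun m => -(c m * ((Lc : ℝ) ^ (d + 1))⁻¹))
          (fun m => unitK (sfStep Lc m) (smStep d Lc m) (coDressKBmAt (toSite r) Lc (KInvStep (d := d) Lc m))) Lc n k₀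
          (fun κ u κ' u' => bsumPow Lc k₀ (W κ u κ' u'))) (θ * C + Cg * g) δ)
    (Hw : ∀ p q (W : (Fin (d + 1) → (Fin (d + 1) → ℤ) → Fin (d + 1) → (Fin (d + 1) → ℤ) → MKer (d + 1) (Fib d))) (C g : ℝ), q < k₀ → P W →
      (∃ B : ℝ, ∀ κ u κ' u' x z a b, |W κ u κ' u' x z a b| ≤ B) → LocStencil₂ W C δS → GoodLS W g →
        LocStencil₂ (legChain (fun m => -(c m * ((Lc : ℝ) ^ (d + 1))⁻¹))
          (fun m => unitK (sfStep Lc m) (smStep d Lc m) (coDressKBmAt (toSite r) Lc (KInvStep (d := d) Lc m))) Lc p q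
          (fun κ u κ' u' => bsumPow Lc q (W κ u κ' u'))) (A * C + B * g) δ)
    (HS : ∀ n, LocStencil₂ (fun κ u κ' u' => rdiv (F n κ u κ' u')) CF δS) (HSL : ∀ n, GoodLS (fun κ u κ' u' => rdiv (F n κ u κ' u')) gF)
    (Hx0 : LocStencil₂ (fun κ u κ' u' => rdiv (T 0 κ u κ' u')) C₀ δS) (HxL0 : GoodLS (fun κ u κ' u' => rdiv (T 0 κ u κ' u')) g₀)
    (H3 : ∀ n, GoodL (fun κ u κ' u' => rdiv (T n κ u κ' u')) σ) (n : ℕ) :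
    LocStencil₂ (fun κ u κ' u' => rdiv (T n κ u κ' u')) (A * C₀ + B * g₀ + k₀ * (A * CF + B * gF) + (Cg * σ + k₀ * (A * CF + B * gF)) * (1 - θ)⁻¹) δ := by
  have hK : ∀ m, ∃ δ C : ℝ, 0 < δ ∧ Decays (unitK (sfStep Lc m) (smStep d Lc m) (coDressKBmAt (toSite r) Lc (KInvStep (d := d) Lc m))) C δ := by
    intro m
    obtain ⟨δK, CK, hδK, -, hG⟩ := decays_coDressKBmAt_KInvStep (d := d) hr m
    exact ⟨δK, _, hδK, decays_unitK hG⟩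
  have hTb : ∀ m, ∃ B : ℝ, ∀ κ u κ' u' x z a b, |T m κ u κ' u' x z a b| ≤ B := by
    intro m
    induction m with
    | zero => exact hT0
    | succ m ih =>
      obtain ⟨δ', C', hδ', hKm⟩ := hK m
      rw [hrec m]
      exact bdd₄_add (Lin4Additive.lin4_bdd hKm hδ' (c m) Lc ih) (hF m)
  have hstep : ∀ m κ u κ' u', rdiv (T (m + 1) κ u κ' u')
      = legStep (-(c m * ((Lc : ℝ) ^ (d + 1))⁻¹)) (unitK (sfStep Lc m) (smStep d Lc m) (coDressKBmAt (toSite r) Lc (KInvStep (d := d) Lc m)))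
          (unitK (sfStep Lc m) (smStep d Lc m) (coDressKBmAt (toSite r) Lc (KInvStep (d := d) Lc m))) Lc
          (fun κ u κ' u' => bsum Lc (rdiv (T m κ u κ' u'))) κ u κ' u' + rdiv (F m κ u κ' u') := by
    intro m κ u κ' u'
    obtain ⟨δ', C', hδ', hKm⟩ := hK m
    obtain ⟨B', hB'⟩ := hTb m
    rw [hrec m]
    exact rdiv_lin4_affine hKm hδ' (one_le_of_neZero Lc) (c m) hB' (hH_unitK_comb hr m) (hM_unitK_comb m) (F m) κ u κ' u'
  exact good_rdiv_tower_of_windows_slaved_mem₀ (N := Lc) (kc := (fun m => -(c m * ((Lc : ℝ) ^ (d + 1))⁻¹)))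
    (K := (fun m => unitK (sfStep Lc m) (smStep d Lc m) (coDressKBmAt (toSite r) Lc (KInvStep (d := d) Lc m)))) hK hTb hF hstep P hxP hFP
    (Good := fun X C => LocStencil₂ X C δ) (GoodL := GoodL) (GoodS := fun X C => LocStencil₂ X C δS) (GoodLS := GoodLS)
    (fun _ _ _ _ hX hY => locStencil₂_add hX hY) (fun _ _ _ hCC hX => locStencil₂_mono hX hCC) (locStencil₂_zero (d := d) δ)
    hk hθ0 hθ1 hCg hA hB hCF hgF hC₀ hg₀ hσ H1 Hw HS HSL Hx0 HxL0 H3 n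

end Comb

end Summit.QuantumFields.BalabanUV.Beta.GAN24.LegTowerWindowSources
end
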